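import Literature.NumberTheory.Automorphic.RankOneBruhat
import Literature.NumberTheory.Automorphic.RootSubgroupStructure
import Literature.NumberTheory.Automorphic.SolvableGroupTori
import Literature.NumberTheory.Automorphic.ChevalleyLineStabilizer
import Literature.NumberTheory.Automorphic.ConeWeights
import Literature.NumberTheory.Automorphic.AffineCurveCriterion
import Literature.NumberTheory.Automorphic.JordanDecompositionAlgGroup
import Literature.NumberTheory.Automorphic.AlgebraicHomImages
import HarnessLib

/-!
# The orbit of the highest weight line in semisimple rank one, I: data, fixed points, weights
(trunk T-AUTOMORPHIC, G25 AutomorphicL; towards `bruhat_rankOne_of_central`, Springer 7.1.5, 7.2.2)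

First half of the `k`-points version of Springer's analysis of `G/B` for a group of semisimple
rank one (*Linear Algebraic Groups*, 2nd ed., 7.1.5: "*`T` lies in at most two Borel groups*",
"*the points `x₀*` and `y_∞*` are fixed points for the action of `φ(T)` on `P(V)`*"; 7.2.2 (i):
the Bruhat decomposition `G = B ∪ U n B`), in the cone language of `ZariskiCones.lean` and with
the representation of Chevalley's theorem 5.5.3 (`ChevalleyLineStabilizer.lean`):

* `isClosed_orbitCone_of_borel_le_lineStabilizer` (**named fact**, Springer 6.2.7 (ii) with
  6.1.2 (iii): a Borel subgroup is parabolic, so the orbit of a line it fixes is closed);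
* `mem_or_mem_of_mem_normalizer_of_central` (**proved**, 7.1.4–7.1.5 (i)): `N_G(T) = T ∪ m T` when
  `Z_G(T) = T`, `(Ker α)°` is central and `m ∈ N_G(T) ∖ Z_G(T)`;
* `RankOneOrbitData G T α u m ρ v` (hypothesis structure): `G` connected with maximal torus `T`,
  `Z_G(T) = T`, a root `α` with `(Ker α)°` central, a root homomorphism `u` with `B = T · u(𝔾ₐ)`
  Borel, a Weyl element `m`, and a rational representation `ρ` with `ρ(T)` diagonal, a vector
  `v ≠ 0` whose line has stabiliser exactly `B`, and closed orbit cone;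
* proved from the data: `not_mem_borel` (`m ∉ B`), `sq_mem` (`m² ∈ T`, 7.2.1),
  `mem_or_exists_of_conj_le` and **`smul_or_smul_of_fixed`** (the `T`-fixed points of `G · [v]` are
  `[v]` and `[ρ(m) v]`: conjugacy of maximal tori in `B`, `isMaximalTorusIn_conj_of_isSolvable_holds`,
  and `N_G(T) = T ∪ m T`), the weights `wt i : T → 𝔾ₘ` of the diagonal `ρ(T)` (`rho_torus_mulVec`,
  algebraic: `wtL`), a cocharacter `γ` with `⟨α, γ⟩ > 0` (`exists_cochar_pos`, 3.2.11 (i)),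
  `rho_cochar` (`ρ(γ(c)) = diag(c^{⟨χᵢ, γ⟩})`, cf. `ConeWeights.weightDiagGL`),
  `exists_forall_rho_eq_smul` (`S = (Ker α)°` acts on the orbit cone by scalars) and the
  **separation lemma** `wt_eq_of_wtInt_eq` (on the support of a point of the orbit cone, equal
  `γ`-weights force equal characters; 7.1.4 "*`T/S` is isomorphic to `𝔾ₘ`*" via
  `exists_zpow_eq_zpow_of_mem_charactersTrivialOn`).

The second half (limits `botPart`, extremal weights, the affine slice, finite fibres, the curve
`U · [ρ(m) v]` and the Bruhat decomposition via `AffineCurveCriterion`) is the sequel file.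

## References

* [SpringerLAG1998] T. A. Springer, *Linear Algebraic Groups*, 2nd ed. (1998): 3.2.11, 5.5.3,
  6.1.2, 6.2.7, 7.1.1, 7.1.4–7.1.5, 7.2.1–7.2.2.
-/

open scoped MatrixGroups IsMulCommutative
open Matrix

namespace Literature.NumberTheory.Automorphic

variable {k : Type*} [Field k] {n : Type*} [Fintype n] [DecidableEq n]

attribute [local instance] zariskiTopologyPi

/-! ### Named fact: orbits of lines with a Borel subgroup in the stabiliser are closed -/

section Fact

/-- **Named fact (Springer 6.2.7 (ii) with 6.1.2 (iii)): the orbit of a point whose isotropy group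
contains a Borel subgroup is closed.** Springer 6.2.7: "*(ii) A Borel subgroup is parabolic*" (a
closed subgroup `P` is parabolic when "*the quotient variety `G/P` is complete*", 6.2.1), and 6.1.2:
"*(iii) If `φ : X → Y` is a morphism then `φ X` is closed and complete*" for `X` complete. Hence for
a `G`-variety `X` and `x ∈ X` whose isotropy group contains a Borel subgroup `B`, the orbit
`G.x`, the image of the complete variety `G/B` under the morphism induced by `g ↦ g.x` (5.5.5),
is closed. Stated on `k`-points for the projective space of a rational representation: `G ≤ GL n k`
Zariski-connected over an algebraically closed field, `B` a Borel subgroup, `ρ : G → GL_N(k)`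
an algebraic homomorphism and `v ∈ kᴺ` whose line is fixed by `B`; conclusion: the orbit cone
`{c ρ(g) v}` (the cone over `G · [v] ⊂ ℙ(kᴺ)`, with `0`) is Zariski closed in `kᴺ`.
[cite: SpringerLAG1998, 6.2.7 (ii) with 6.1.2 (iii)] -/
def isClosed_orbitCone_of_borel_le_lineStabilizer : Prop :=
  ∀ [IsAlgClosed k] {G B : Subgroup (GL n k)}, IsZConnected G → IsBorelIn B G →
    ∀ {N : ℕ} (ρ : ↥G →* GL (Fin N) k), MonoidHom.IsAlgebraicGL ρ → ∀ v : Fin N → k,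
      (∀ b : ↥G, (b : GL n k) ∈ B → ∃ c : k, ((ρ b : GL (Fin N) k) : Matrix (Fin N) (Fin N) k) *ᵥ v = c • v) →
      IsClosed (orbitCone ρ.range v)

end Fact

/-! ### The Weyl group of a group of semisimple rank one: `N_G(T) = T ∪ m T` -/

section Weyl

variable {G T : Subgroup (GL n k)}

/-- **`N_G(T) = T ∪ m T` in semisimple rank one** (Springer 7.1.4–7.1.5 (i): the Weyl group of
`G_α` has order two; here for `G` algebraic with a maximal torus `T` such that `Z_G(T) = T`, a root
`α` with `(Ker α)°` central and `m ∈ N_G(T) ∖ Z_G(T)`): an element of `N_G(T)` maps `α` to `±α`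
(`charConj_eq_or_eq_inv_of_central`); if it fixes `α` it centralises `T`
(`mem_centralizer_of_charConj_eq_of_central`), and two elements inverting `α` differ by such.
[cite: SpringerLAG1998, 7.1.4–7.1.5 (i)] -/
theorem mem_or_mem_of_mem_normalizer_of_central [IsAlgClosed k] (hG : IsAlgebraicSubgroup G)
    (hT : IsTorusSubgroup T) (hZT : G ⊓ Subgroup.centralizer (T : Set (GL n k)) = T)
    {α : ↥(characterLattice T)} (hα1 : (α : ↥T →* kˣ) ≠ 1)
    (hcen : G ≤ Subgroup.centralizer
      ((identityComponent ((α : ↥T →* kˣ).ker.map T.subtype) : Subgroup (GL n k)) :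
        Set (GL n k)))
    {m : GL n k} (hmG : m ∈ G) (hmN : m ∈ Subgroup.normalizer (T : Set (GL n k)))
    (hmZ : m ∉ Subgroup.centralizer (T : Set (GL n k)))
    {x : GL n k} (hxG : x ∈ G) (hxN : x ∈ Subgroup.normalizer (T : Set (GL n k))) :
    x ∈ T ∨ m⁻¹ * x ∈ T := by
  have hmem : ∀ {y : GL n k}, y ∈ G → y ∈ Subgroup.centralizer (T : Set (GL n k)) → y ∈ T :=
    fun hyG hyZ => by rw [← hZT]; exact ⟨hyG, hyZ⟩
  have hminv : charConj hmN α = α⁻¹ := by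
    rcases charConj_eq_or_eq_inv_of_central hG hT hα1 hcen hmG hmN with h | h
    · exact absurd (mem_centralizer_of_charConj_eq_of_central hG hT hα1 hcen hmG hmN h) hmZ
    · exact h
  rcases charConj_eq_or_eq_inv_of_central hG hT hα1 hcen hxG hxN with h | h
  · exact Or.inl (hmem hxG (mem_centralizer_of_charConj_eq_of_central hG hT hα1 hcen hxG hxN h))
  · right
    have hm'N : m⁻¹ * x ∈ Subgroup.normalizer (T : Set (GL n k)) :=
      Subgroup.mul_mem _ (Subgroup.inv_mem _ hmN) hxN
    have hm'G : m⁻¹ * x ∈ G := G.mul_mem (G.inv_mem hmG) hxG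
    refine hmem hm'G (mem_centralizer_of_charConj_eq_of_central hG hT hα1 hcen hm'G hm'N ?_)
    have e₁ : charConj (Subgroup.inv_mem _ hmN) α = α⁻¹ := by
      have h1 := charConj_inv_charConj hmN α
      rw [hminv, map_inv, inv_eq_iff_eq_inv] at h1
      exact h1
    rw [show charConj hm'N α = charConj hxN (charConj (Subgroup.inv_mem _ hmN) α) from
      charConj_mul (Subgroup.inv_mem _ hmN) hxN α, e₁, map_inv, h, inv_inv]

end Weyl

/-! ### The data of the rank-one orbit analysis (Springer 7.1.5, 7.2.2) -/

section Data

/-- **The data of Springer's analysis of `G/B ⊂ ℙ(V)` in semisimple rank one** (7.1.5, 7.2.2),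
on `k`-points: a Zariski-connected `G ≤ GL n k` with a maximal torus `T` such that `Z_G(T) = T`,
a root `α` with `(Ker α)°` central, a root homomorphism `u` for `α` such that `B = T · u(𝔾ₐ)` is a
Borel subgroup, a Weyl element `m ∈ N_G(T) ∖ Z_G(T)`, and a rational representation
`ρ : G → GL_N(k)` with a vector `v ≠ 0` whose line has stabiliser exactly `B` (5.5.3), such that
`ρ(T)` is diagonal and the orbit cone of `v` is closed (6.2.7 (ii)). [cite: SpringerLAG1998, 7.1.5 (proof)] -/
structure RankOneOrbitData (G T : Subgroup (GL n k)) (α : ↥(characterLattice T))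
    (u : Multiplicative k →* ↥G) (m : GL n k) {N : ℕ} (ρ : ↥G →* GL (Fin N) k)
    (v : Fin N → k) : Prop where
  /-- `G` is Zariski-connected. -/
  conn : IsZConnected G
  /-- `T` is a maximal torus of `G`. -/
  maxTorus : IsMaximalTorusIn T G
  /-- `α` is a root. -/
  mem_roots : α ∈ roots G T
  /-- `(Ker α)°` is central in `G`. -/
  central : G ≤ Subgroup.centralizer
    ((identityComponent ((α : ↥T →* kˣ).ker.map T.subtype) : Subgroup (GL n k)) : Set (GL n k))
  /-- `u` is a root homomorphism for `α`. -/
  rootHom : IsRootHom G T maxTorus.1 (α : ↥T →* kˣ) u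
  /-- `B = T · u(𝔾ₐ)` is a Borel subgroup of `G`. -/
  borel : IsBorelIn (T ⊔ u.range.map G.subtype) G
  /-- `Z_G(T) = T`. -/
  centralizer_eq : G ⊓ Subgroup.centralizer (T : Set (GL n k)) = T
  /-- `m ∈ G`. -/
  memG : m ∈ G
  /-- `m` normalises `T`. -/
  memN : m ∈ Subgroup.normalizer (T : Set (GL n k))
  /-- `m` does not centralise `T`. -/
  notMemZ : m ∉ Subgroup.centralizer (T : Set (GL n k))
  /-- `ρ` is an algebraic homomorphism. -/
  algebraic : MonoidHom.IsAlgebraicGL ρ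
  /-- `v ≠ 0`. -/
  ne_zero : v ≠ 0
  /-- The stabiliser of the line `k v` in `G` is exactly `B`. -/
  stab_iff : ∀ g : ↥G, (∃ c : k, ((ρ g : GL (Fin N) k) : Matrix (Fin N) (Fin N) k) *ᵥ v = c • v) ↔
    (g : GL n k) ∈ T ⊔ u.range.map G.subtype
  /-- `ρ(T)` consists of diagonal matrices. -/
  diag : ∀ t : ↥T, ∃ d : Fin N → k,
    ((ρ ⟨t, maxTorus.1 t.2⟩ : GL (Fin N) k) : Matrix (Fin N) (Fin N) k) = Matrix.diagonal d
  /-- The orbit cone of `v` under `ρ(G)` is closed. -/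
  closed : IsClosed (orbitCone ρ.range v)

namespace RankOneOrbitData

variable {G T : Subgroup (GL n k)} {α : ↥(characterLattice T)} {u : Multiplicative k →* ↥G}
  {m : GL n k} {N : ℕ} {ρ : ↥G →* GL (Fin N) k} {v : Fin N → k}
variable (h : RankOneOrbitData G T α u m ρ v)
include h

/-- `G` is algebraic. [folklore] -/
theorem alg : IsAlgebraicSubgroup G := h.conn.1

/-- `T` is a torus. [folklore] -/
theorem torus : IsTorusSubgroup T := h.maxTorus.2.1

/-- `α ≠ 1`. [folklore] -/
theorem ne_one : (α : ↥T →* kˣ) ≠ 1 := h.mem_roots.1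

/-- `m ∉ B`: an element `t u(x)` of `B` normalising `T` has `x = 0`, so lies in `T ⊆ Z_G(T)`.
[cite: SpringerLAG1998, 7.2.1] -/
theorem not_mem_borel [IsAlgClosed k] : m ∉ T ⊔ u.range.map G.subtype := by
  haveI : IsMulCommutative ↥T := h.torus.2.1
  intro hmB
  obtain ⟨t, ht, x, e⟩ := h.rootHom.mem_sup_iff.1 hmB
  have hsurj := surjective_of_mem_roots h.torus h.mem_roots
  have hx : x = 0 := by
    refine h.rootHom.eq_zero_of_torus_mul_uval_mem_normalizer h.torus hsurj ht fun s => ?_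
    rw [← e]
    exact (Subgroup.mem_normalizer_iff''.1 h.memN s).1 s.2
  rw [hx, uval_zero, mul_one] at e
  apply h.notMemZ
  rw [e]
  exact Subgroup.mem_centralizer_iff.2 fun s hs =>
    congrArg Subtype.val (mul_comm (⟨s, hs⟩ : ↥T) ⟨t, ht⟩)

/-- `N_G(T) = T ∪ m T`. [cite: SpringerLAG1998, 7.1.5 (i)] -/
theorem mem_or_mem [IsAlgClosed k] {x : GL n k} (hxG : x ∈ G)
    (hxN : x ∈ Subgroup.normalizer (T : Set (GL n k))) : x ∈ T ∨ m⁻¹ * x ∈ T :=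
  mem_or_mem_of_mem_normalizer_of_central h.alg h.torus h.centralizer_eq h.ne_one h.central h.memG
    h.memN h.notMemZ hxG hxN

omit h in
/-- `G` is its own conjugate by an element of `G`. [folklore] -/
theorem map_conj_eq_of_mem {g : GL n k} (hg : g ∈ G) :
    G.map (MulAut.conj g : GL n k →* GL n k) = G := by
  ext x
  constructor
  · rintro ⟨y, hy, rfl⟩
    exact G.mul_mem (G.mul_mem hg hy) (G.inv_mem hg)
  · intro hx
    exact ⟨g⁻¹ * x * g, G.mul_mem (G.mul_mem (G.inv_mem hg) hx) hg, by simp [MulAut.conj_apply, mul_assoc]⟩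

/-- `m² ∈ T`. [cite: SpringerLAG1998, 7.2.1] -/
theorem sq_mem [IsAlgClosed k] : m * m ∈ T := by
  haveI : IsMulCommutative ↥T := h.torus.2.1
  rcases h.mem_or_mem (G.mul_mem h.memG h.memG) (Subgroup.mul_mem _ h.memN h.memN) with h1 | h1
  · exact h1
  · rw [← mul_assoc, inv_mul_cancel, one_mul] at h1
    exact absurd (Subgroup.mem_centralizer_iff.2 fun s hs =>
      congrArg Subtype.val (mul_comm (⟨s, hs⟩ : ↥T) ⟨m, h1⟩)) h.notMemZ

/-- **The `T`-fixed points of `G/B`** (Springer 7.1.4: the Borel subgroups containing `T`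
correspond to the Weyl group; 7.1.5 (i)): if `g⁻¹ T g ⊆ B` then `g ∈ B` or `g ∈ m B`
(conjugacy of maximal tori in `B`, `isMaximalTorusIn_conj_of_isSolvable_holds`, and
`N_G(T) = T ∪ m T`). [cite: SpringerLAG1998, 7.1.4–7.1.5 (i)] -/
theorem mem_or_exists_of_conj_le [IsAlgClosed k] {g : GL n k} (hg : g ∈ G)
    (hle : T.map (MulAut.conj g⁻¹ : GL n k →* GL n k) ≤ T ⊔ u.range.map G.subtype) :
    g ∈ T ⊔ u.range.map G.subtype ∨ ∃ b ∈ T ⊔ u.range.map G.subtype, g = m * b := by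
  set B := T ⊔ u.range.map G.subtype with hB
  have hBor := h.borel
  -- `g⁻¹ T g` and `T` are maximal tori of `B`
  have h1 : IsMaximalTorusIn (T.map (MulAut.conj g⁻¹ : GL n k →* GL n k)) B := by
    have h0 := h.maxTorus.map_conj g⁻¹
    rw [map_conj_eq_of_mem (G.inv_mem hg)] at h0
    exact ⟨hle, h0.2.1, fun T' a b c => h0.2.2 T' a (b.trans hBor.1) c⟩
  have h2 : IsMaximalTorusIn T B :=
    ⟨le_sup_left, h.torus, fun T' a b c => h.maxTorus.2.2 T' a (b.trans hBor.1) c⟩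
  obtain ⟨b, hb, hbT⟩ := isMaximalTorusIn_conj_of_isSolvable_holds hBor.2.1 hBor.2.2.1 h2 h1
  -- `x = b⁻¹ g⁻¹` normalises `T`
  have hx : T.map (MulAut.conj (b⁻¹ * g⁻¹) : GL n k →* GL n k) = T := by
    rw [← map_conj_map_conj, hbT, map_conj_inv_map_conj]
  have hxN : b⁻¹ * g⁻¹ ∈ Subgroup.normalizer (T : Set (GL n k)) :=
    Subgroup.mem_normalizer_iff_map_conj_eq.2 hx
  have hbG : b ∈ G := hBor.1 hb
  have hxG : b⁻¹ * g⁻¹ ∈ G := G.mul_mem (G.inv_mem hbG) (G.inv_mem hg)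
  rcases h.mem_or_mem hxG hxN with h3 | h3
  · left
    have : g = (b⁻¹ * g⁻¹)⁻¹ * b⁻¹ := by group
    rw [this]
    exact B.mul_mem (B.inv_mem (Subgroup.mem_sup_left h3)) (B.inv_mem hb)
  · right
    -- `m⁻¹ b⁻¹ g⁻¹ = t ∈ T`, so `g = t⁻¹ m⁻¹ b⁻¹ = m (m⁻¹ t⁻¹ m) m⁻² b⁻¹`
    have ht' : m⁻¹ * (m⁻¹ * (b⁻¹ * g⁻¹))⁻¹ * m ∈ T :=
      (Subgroup.mem_normalizer_iff''.1 h.memN _).1 (T.inv_mem h3)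
    refine ⟨m⁻¹ * (m⁻¹ * (b⁻¹ * g⁻¹))⁻¹ * m * (m * m)⁻¹ * b⁻¹, B.mul_mem (B.mul_mem
      (Subgroup.mem_sup_left ht') (Subgroup.mem_sup_left (T.inv_mem h.sq_mem))) (B.inv_mem hb), ?_⟩
    group

omit h in
/-- `ρ` of a product, on vectors. [folklore] -/
theorem rho_mul_mulVec (a b : ↥G) (w : Fin N → k) :
    ((ρ (a * b) : GL (Fin N) k) : Matrix (Fin N) (Fin N) k) *ᵥ w =
      ((ρ a : GL (Fin N) k) : Matrix (Fin N) (Fin N) k) *ᵥ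
        (((ρ b : GL (Fin N) k) : Matrix (Fin N) (Fin N) k) *ᵥ w) := by
  rw [map_mul, Units.val_mul, Matrix.mulVec_mulVec]

/-- Elements of `B` fix the line of `v`. [folklore] -/
theorem exists_smul_of_mem_borel {b : GL n k} (hbG : b ∈ G) (hb : b ∈ T ⊔ u.range.map G.subtype) :
    ∃ c : k, ((ρ ⟨b, hbG⟩ : GL (Fin N) k) : Matrix (Fin N) (Fin N) k) *ᵥ v = c • v :=
  (h.stab_iff ⟨b, hbG⟩).2 hb

/-- If `ρ(t)` fixes the line of `ρ(g) v` then `g⁻¹ t g ∈ B`. [folklore] -/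
theorem conj_mem_borel_of_fixed {g : ↥G} {t : GL n k} (htG : t ∈ G)
    (hfix : ∃ c : k, ((ρ ⟨t, htG⟩ : GL (Fin N) k) : Matrix (Fin N) (Fin N) k) *ᵥ
      (((ρ g : GL (Fin N) k) : Matrix (Fin N) (Fin N) k) *ᵥ v) =
      c • (((ρ g : GL (Fin N) k) : Matrix (Fin N) (Fin N) k) *ᵥ v)) :
    (g : GL n k)⁻¹ * t * g ∈ T ⊔ u.range.map G.subtype := by
  obtain ⟨c, hc⟩ := hfix
  have hmem : (g : GL n k)⁻¹ * t * g ∈ G := G.mul_mem (G.mul_mem (G.inv_mem g.2) htG) g.2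
  have key : ((ρ ⟨(g : GL n k)⁻¹ * t * g, hmem⟩ : GL (Fin N) k) : Matrix (Fin N) (Fin N) k) *ᵥ v =
      c • v := by
    have e : (⟨(g : GL n k)⁻¹ * t * g, hmem⟩ : ↥G) = g⁻¹ * ⟨t, htG⟩ * g := rfl
    rw [e, rho_mul_mulVec, rho_mul_mulVec, hc, Matrix.mulVec_smul, ← rho_mul_mulVec,
      inv_mul_cancel, map_one, Units.val_one, Matrix.one_mulVec]
  exact (h.stab_iff _).1 ⟨c, key⟩

/-- **`X^T = {x₀, x_∞}`** (Springer 7.1.5 (i): "*`T` lies in at most two Borel groups*", and the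
fixed points of `T` in `G/B` are the Borel subgroups containing `T`): if the line of `ρ(g) v` is
fixed by `ρ(T)` then `ρ(g) v` is a multiple of `v` or of `ρ(m) v`.
[cite: SpringerLAG1998, 7.1.5 (i) (proof)] -/
theorem smul_or_smul_of_fixed [IsAlgClosed k] {g : ↥G}
    (hfix : ∀ t : ↥T, ∃ c : k, ((ρ ⟨t, h.maxTorus.1 t.2⟩ : GL (Fin N) k) : Matrix (Fin N) (Fin N) k) *ᵥ
      (((ρ g : GL (Fin N) k) : Matrix (Fin N) (Fin N) k) *ᵥ v) =
      c • (((ρ g : GL (Fin N) k) : Matrix (Fin N) (Fin N) k) *ᵥ v)) :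
    (∃ c : k, ((ρ g : GL (Fin N) k) : Matrix (Fin N) (Fin N) k) *ᵥ v = c • v) ∨
      ∃ c : k, ((ρ g : GL (Fin N) k) : Matrix (Fin N) (Fin N) k) *ᵥ v =
        c • (((ρ ⟨m, h.memG⟩ : GL (Fin N) k) : Matrix (Fin N) (Fin N) k) *ᵥ v) := by
  have hle : T.map (MulAut.conj (g : GL n k)⁻¹ : GL n k →* GL n k) ≤ T ⊔ u.range.map G.subtype := by
    rintro _ ⟨t, ht, rfl⟩
    have := h.conj_mem_borel_of_fixed (g := g) (h.maxTorus.1 ht) (hfix ⟨t, ht⟩)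
    simpa [MulAut.conj_apply, mul_assoc] using this
  rcases h.mem_or_exists_of_conj_le g.2 hle with hgB | ⟨b, hb, hgb⟩
  · exact Or.inl ((h.stab_iff g).2 hgB)
  · right
    have hbG : b ∈ G := h.borel.1 hb
    obtain ⟨c, hc⟩ := h.exists_smul_of_mem_borel hbG hb
    refine ⟨c, ?_⟩
    have e : g = ⟨m, h.memG⟩ * ⟨b, hbG⟩ := Subtype.ext hgb
    rw [e, rho_mul_mulVec, hc, Matrix.mulVec_smul]

/-! #### The weights of `T` on `kᴺ` -/

/-- The diagonal entries of `ρ(t)`: `ρ(t) = diag(ρ(t)ᵢᵢ)`. [folklore] -/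
theorem rho_torus_eq_diagonal (t : ↥T) :
    ((ρ ⟨t, h.maxTorus.1 t.2⟩ : GL (Fin N) k) : Matrix (Fin N) (Fin N) k) =
      Matrix.diagonal fun i => ((ρ ⟨t, h.maxTorus.1 t.2⟩ : GL (Fin N) k) : Matrix (Fin N) (Fin N) k) i i := by
  obtain ⟨d, hd⟩ := h.diag t
  rw [hd]
  ext i j
  by_cases hij : i = j
  · subst hij; simp
  · simp [Matrix.diagonal_apply_ne _ hij]

/-- The diagonal entries of `ρ(t)` are non-zero. [folklore] -/
theorem rho_torus_apply_ne_zero (t : ↥T) (i : Fin N) :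
    ((ρ ⟨t, h.maxTorus.1 t.2⟩ : GL (Fin N) k) : Matrix (Fin N) (Fin N) k) i i ≠ 0 := by
  intro h0
  have hdet := (ρ ⟨t, h.maxTorus.1 t.2⟩).isUnit.map Matrix.detMonoidHom
  rw [Matrix.coe_detMonoidHom, h.rho_torus_eq_diagonal t, Matrix.det_diagonal] at hdet
  apply hdet.ne_zero
  exact Finset.prod_eq_zero (Finset.mem_univ i) (by simpa using h0)

/-- **The weights `χᵢ : T → 𝔾ₘ` of `T` on `kᴺ`**: `ρ(t) = diag(χᵢ(t))` (Springer 7.1.1: the weights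
of `T` in `V`). [cite: SpringerLAG1998, 7.1.1] -/
noncomputable def wt (i : Fin N) : ↥T →* kˣ where
  toFun t := Units.mk0 _ (h.rho_torus_apply_ne_zero t i)
  map_one' := Units.ext (by
    simp only [Units.val_mk0, Units.val_one]
    have : (⟨((1 : ↥T) : GL n k), h.maxTorus.1 (1 : ↥T).2⟩ : ↥G) = 1 := rfl
    rw [this, map_one, Units.val_one, Matrix.one_apply_eq])
  map_mul' s t := Units.ext (by
    simp only [Units.val_mk0, Units.val_mul]
    have : (⟨((s * t : ↥T) : GL n k), h.maxTorus.1 (s * t).2⟩ : ↥G) =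
        ⟨(s : GL n k), h.maxTorus.1 s.2⟩ * ⟨(t : GL n k), h.maxTorus.1 t.2⟩ := rfl
    rw [this, map_mul, Units.val_mul, h.rho_torus_eq_diagonal s, h.rho_torus_eq_diagonal t,
      Matrix.diagonal_mul_diagonal, Matrix.diagonal_apply_eq, Matrix.diagonal_apply_eq,
      Matrix.diagonal_apply_eq])

/-- `χᵢ(t) = ρ(t)ᵢᵢ`. [folklore] -/
@[simp] theorem coe_wt (i : Fin N) (t : ↥T) :
    ((h.wt i t : kˣ) : k) = ((ρ ⟨t, h.maxTorus.1 t.2⟩ : GL (Fin N) k) : Matrix (Fin N) (Fin N) k) i i := rfl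

/-- `ρ(t) w = (χᵢ(t) wᵢ)ᵢ`. [folklore] -/
theorem rho_torus_mulVec (t : ↥T) (w : Fin N → k) :
    ((ρ ⟨t, h.maxTorus.1 t.2⟩ : GL (Fin N) k) : Matrix (Fin N) (Fin N) k) *ᵥ w =
      fun i => ((h.wt i t : kˣ) : k) * w i := by
  rw [h.rho_torus_eq_diagonal t]
  funext i
  rw [Matrix.mulVec_diagonal]
  rfl

/-- The weights are algebraic characters (`ρ` is algebraic). [folklore] -/
theorem isAlgebraicChar_wt (i : Fin N) : IsAlgebraicChar (h.wt i) := by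
  obtain ⟨P, hP⟩ := h.algebraic
  refine ⟨P (Sum.inl (i, i)), fun t => ?_⟩
  rw [coe_wt, ← glCoordFun_inl, hP]

/-- The weight `χᵢ` as an element of `X*(T)`. [folklore] -/
noncomputable def wtL (i : Fin N) : ↥(characterLattice T) := ⟨h.wt i, h.isAlgebraicChar_wt i⟩

/-- `wtL` coerces to `wt`. [folklore] -/
@[simp] theorem coe_wtL (i : Fin N) : (h.wtL i : ↥T →* kˣ) = h.wt i := rfl

/-- **A cocharacter `λ` with `⟨α, λ⟩ > 0`** (by the perfect pairing 3.2.11 (i),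
`exists_dualBases_of_isTorusSubgroup`). [folklore] -/
theorem exists_cochar_pos [IsAlgClosed k] :
    haveI : IsMulCommutative ↥T := h.torus.2.1
    ∃ γ : ↥(cocharacterLattice T), 0 < charPairingInt (α : ↥T →* kˣ) (γ : kˣ →* ↥T) := by
  haveI : IsMulCommutative ↥T := h.torus.2.1
  obtain ⟨r, bX, bY, hpair⟩ := exists_dualBases_of_isTorusSubgroup h.torus
  have hne : bX (Additive.ofMul α) ≠ 0 := by
    intro h0
    apply h.ne_one
    have : Additive.ofMul α = 0 := bX.injective (by rw [h0, map_zero])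
    rw [show α = 1 from Additive.ofMul.injective this, Subgroup.coe_one]
  obtain ⟨i, hi⟩ : ∃ i, bX (Additive.ofMul α) i ≠ 0 := by
    by_contra! h0; exact hne (funext h0)
  set d : ℤ := bX (Additive.ofMul α) i with hd
  -- the cocharacter `± e_i^∨`
  set γ : ↥(cocharacterLattice T) := Additive.toMul (bY.symm (Pi.single i (Int.sign d))) with hγ
  refine ⟨γ, ?_⟩
  rw [hpair, hγ]
  simp only [ofMul_toMul, AddEquiv.apply_symm_apply]
  rw [Finset.sum_eq_single i]
  · rw [Pi.single_eq_same, ← hd]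
    rcases lt_trichotomy d 0 with hlt | heq | hgt
    · rw [Int.sign_eq_neg_one_of_neg hlt]; nlinarith
    · exact absurd heq hi
    · rw [Int.sign_eq_one_of_pos hgt]; linarith
  · intro j _ hji; rw [Pi.single_eq_of_ne hji, mul_zero]
  · intro hi'; exact absurd (Finset.mem_univ i) hi'

/-- The integer weights `mᵢ = ⟨χᵢ, γ⟩` of a cocharacter `γ` on `kᴺ`. [folklore] -/
noncomputable def wtInt [IsMulCommutative ↥T] (γ : ↥(cocharacterLattice T)) (i : Fin N) : ℤ :=
  charPairingInt (h.wt i) (γ : kˣ →* ↥T)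

/-- **`ρ(γ(c)) = diag(c^{mᵢ})`** (`χᵢ(γ(c)) = c^{⟨χᵢ, γ⟩}`, 3.2.11 (i) /
`charPairingInt_spec_holds`). [cite: SpringerLAG1998, 3.2.11 (i)] -/
theorem rho_cochar [IsAlgClosed k] [IsMulCommutative ↥T] (γ : ↥(cocharacterLattice T)) (c : kˣ) :
    ((ρ ⟨((γ : kˣ →* ↥T) c : GL n k), h.maxTorus.1 ((γ : kˣ →* ↥T) c).2⟩ : GL (Fin N) k) :
        Matrix (Fin N) (Fin N) k) = ((weightDiagGL (h.wtInt γ) c : GL (Fin N) k) : Matrix (Fin N) (Fin N) k) := by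
  rw [h.rho_torus_eq_diagonal ((γ : kˣ →* ↥T) c), weightDiagGL, coe_diagonalGL]
  congr 1
  funext i
  have h1 := charPairingInt_spec_holds (T := T) (h.isAlgebraicChar_wt i) γ.2 c
  rw [← h.coe_wt, h1]
  rfl

/-- **`S = (Ker α)°` acts on the orbit cone by scalars** (`S` is central and fixes the line of `v`).
[folklore] -/
theorem exists_forall_rho_eq_smul {s : GL n k}
    (hs : s ∈ identityComponent ((α : ↥T →* kˣ).ker.map T.subtype)) :
    ∃ (hsG : s ∈ G) (c : k), ∀ w ∈ orbitCone ρ.range v,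
      ((ρ ⟨s, hsG⟩ : GL (Fin N) k) : Matrix (Fin N) (Fin N) k) *ᵥ w = c • w := by
  have hsT : s ∈ T := by
    obtain ⟨t, -, rfl⟩ := identityComponent_le _ hs
    exact t.2
  have hsG : s ∈ G := h.maxTorus.1 hsT
  obtain ⟨c, hc⟩ := h.exists_smul_of_mem_borel hsG (Subgroup.mem_sup_left hsT)
  refine ⟨hsG, c, ?_⟩
  rintro w ⟨a, _, ⟨g, rfl⟩, rfl⟩
  have hcomm : g * ⟨s, hsG⟩ = ⟨s, hsG⟩ * g :=
    Subtype.ext ((Subgroup.mem_centralizer_iff.1 (h.central g.2) s hs).symm)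
  rw [Matrix.mulVec_smul, ← rho_mul_mulVec, ← hcomm, rho_mul_mulVec, hc, Matrix.mulVec_smul,
    smul_comm]

/-- **Separation of weights** (the lattice content of 7.1.4 "*`T/S` is isomorphic to `𝔾ₘ`*"): for a
point `w` of the orbit cone and two indices in its support, if the integer weights of a cocharacter
`γ` with `⟨α, γ⟩ ≠ 0` agree then the characters agree: `χᵢ/χⱼ` is trivial on `S` (which acts on
`w` by a scalar), hence commensurable with `α` (`exists_zpow_eq_zpow_of_mem_charactersTrivialOn`),
and `X*(T)` is torsion-free. [cite: SpringerLAG1998, 7.1.4] -/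
theorem wt_eq_of_wtInt_eq [IsAlgClosed k] [IsMulCommutative ↥T] {γ : ↥(cocharacterLattice T)}
    (hγ : charPairingInt (α : ↥T →* kˣ) (γ : kˣ →* ↥T) ≠ 0) {w : Fin N → k}
    (hw : w ∈ orbitCone ρ.range v) {i j : Fin N} (hi : w i ≠ 0) (hj : w j ≠ 0)
    (hij : h.wtInt γ i = h.wtInt γ j) : h.wt i = h.wt j := by
  haveI := isMulTorsionFree_characterLattice h.torus.1
  -- `χᵢ/χⱼ` is trivial on `S`
  have htriv : h.wtL i / h.wtL j ∈ charactersTrivialOn T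
      (identityComponent ((α : ↥T →* kˣ).ker.map T.subtype)) := by
    rw [mem_charactersTrivialOn_iff]
    intro t ht
    obtain ⟨htG, c, hc⟩ := h.exists_forall_rho_eq_smul ht
    have hw' := hc w hw
    rw [show (⟨(t : GL n k), htG⟩ : ↥G) = ⟨t, h.maxTorus.1 t.2⟩ from rfl, h.rho_torus_mulVec] at hw'
    have h1 := congrFun hw' i
    have h2 := congrFun hw' j
    simp only [Pi.smul_apply, smul_eq_mul] at h1 h2
    have e1 : ((h.wt i t : kˣ) : k) = c := mul_right_cancel₀ hi h1
    have e2 : ((h.wt j t : kˣ) : k) = c := mul_right_cancel₀ hj h2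
    apply Units.ext
    rw [Subgroup.coe_div, MonoidHom.div_apply, Units.val_div_eq_div_val, coe_wtL, coe_wtL, e1, e2,
      div_self (e1 ▸ (h.wt i t).ne_zero), Units.val_one]
  obtain ⟨a, c, ha, hac⟩ := exists_zpow_eq_zpow_of_mem_charactersTrivialOn h.torus h.ne_one htriv
  -- pair with `γ`
  have hpair := congrArg (fun χ : ↥(characterLattice T) => charPairingInt (χ : ↥T →* kˣ) (γ : kˣ →* ↥T)) hac
  simp only [SubgroupClass.coe_zpow] at hpair
  rw [charPairingInt_zpow_left (h.wtL i / h.wtL j).2 γ.2, charPairingInt_zpow_left α.2 γ.2,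
    Subgroup.coe_div, div_eq_mul_inv, charPairingInt_mul_left (h.wtL i).2 (h.wtL j).2.inv γ.2,
    charPairingInt_inv_left (h.wtL j).2 γ.2] at hpair
  have h0 : c = 0 := by
    have : a * (h.wtInt γ i + -h.wtInt γ j) = c * charPairingInt (α : ↥T →* kˣ) (γ : kˣ →* ↥T) := hpair
    rw [hij, add_neg_cancel, mul_zero] at this
    exact (mul_eq_zero.1 this.symm).resolve_right hγ
  rw [h0, zpow_zero] at hac
  have hnat : (h.wtL i / h.wtL j) ^ a.natAbs = 1 := by
    rcases Int.natAbs_eq a with e | e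
    · rw [← zpow_natCast, ← e, hac]
    · rw [← zpow_natCast, ← _root_.inv_inj, ← zpow_neg, ← e, hac, inv_one]
  have h1 : h.wtL i / h.wtL j = 1 :=
    IsMulTorsionFree.pow_left_injective (Int.natAbs_ne_zero.2 ha) (by simpa using hnat)
  rw [div_eq_one] at h1
  rw [← coe_wtL, ← coe_wtL, h1]

end RankOneOrbitData

end Data

end Literature.NumberTheory.Automorphic
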